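/-
Copyright (c) 2026 the pub-hodgecm-mathlib formalisation cell (harness21).  Prover seat hodgecm-mathlib-K2E3-p14 (g10) (E3 hand on strike line L1; LEAD F0P6-plan (g15)
BATCH #251 (a)), Track B «K2-LIT» ∕ hLiu418 = `stmt-HodgeConjecture-24832`: U1-glob LEVEL 2-fin, the ARCH-KERNEL branch — (α) ED.Σ: the arch READING letter for an arch
section presented as a FINITE SUM of frame-pure terms (the U1-side consumer of the shared presentation core, LH4-p17 (g3) `K2LiuIncoherentRankOneArchPlacePresentation`, one
writer), with the per-place continuations taken ABSTRACTLY (and a scalar-type instance over ★ C131-p02).  THEOREMS ONLY (no `def` ∕ `instance` ∕ notation ∕ named-fact hypothesis ∕ `sorry`).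
-/
import Summits.HodgeConjecture.HodgeConjecture.Theorems.K2LiuLocalKernelArchReadingScalarType     -- ★ (α) p864419 (this seat): `exists_continuation_of_frameTensor_scalarType` (+ ★ p864260, ★ C131-p02)
import HarnessLib

/-!
# Crux `HLiu418`, U1-glob LEVEL 2-fin, arch-kernel branch — `K2LiuLocalKernelArchPresentationScalarType`: (α) ED.Σ — THE ARCH BLOCK OF A FINITE SUM OF FRAME-PURE TERMS, CONTINUED
# `∫ F_s dν = Σ_r γ_r(s) · c · ∏_{w} E_{r,w}(s)` on `{½ < re s}`, holomorphic on `{0 < re s}`   [KudlaRallis1994 §2; Shimura1982 §4; HarrisKudlaSweet1996 §1]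

Cell `hodgecm-mathlib`, crux item hLiu418 = `stmt-HodgeConjecture-24832`; squad K2, strike line L1, LEAD F0P6-plan (g15) BATCH #251 (a); U1 desk K2E3-p28 (g4); END pen
K2E3-p32 (g3) (FILE B-arch ★ p864406); shared presentation core = LH4-p17 (g3) (D-arch-P) `K2LiuIncoherentRankOneArchPlacePresentation` (block-D desk K2Liu-p12 (g6) WORD #10;
his 02:04:54Z SIG ∕ 02:05:52Z word: GENERIC head exporting `Ψloc X p w s h m := (if w = w₀ then γ X p s else 1) · eb X w (blk m) · Fs X p w s (Frx X w · m · Frg X h w)` with `hpure`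
per fine face and the sum presentation `hpres : Φ = Σ_r γ·∏_w Fs∘frame`).  Lane `--supports stmt-HodgeConjecture-24832 --as helper` (count-neutral).  THEOREMS ONLY.

THE POINT (census 02:05:38Z «same core, one writer»).  ★ (α) `K2LiuLocalKernelArchReadingScalarType` continues the arch block of ★ FILE 4's `hloc` when its integrand is ONE frame-pure
tensor with the scalar-type coordinate reading `hΨ` of every local factor.  A `K_∞`-finite archimedean section is a FINITE SUM of flat-tube terms (★ `exists_flat_tube_presentation`),
each frame-pure, with an `s`-dependent holomorphic scalar `γ_r` in front (LH4-p17's core, (T)); the character half is frame-pure unconditionally (★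
`K2LiuKindWArchCharacterFrameReading.conj_unipDeltaChar_archToAdelic_eq_prod`, (E)).  THIS FILE continues such a SUM, taking the per-`(r, w)` LOCAL CONTINUATIONS ABSTRACTLY (`hAloc`:
`∃ E_{r,w}` holomorphic on `{0 < re}` with `∫ Ψloc r w s (nfr w ρ) dρ = E_{r,w}(s)` on `{½ < re}` — payer: the rank-one per-place continuation lineage, ★ C131-p02 p863260 ∕ ★ (D-arch-loc)
p864236's `Araw Ac₀ hAc₀ hA₀` letters), so that it composes DIRECTLY with LH4-p17's exported `Ψloc`∕`hpure` (whose `Ψloc` folds `γ` into one place and keeps the local sections `Fs`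
abstract) — and, for the scalar-type route, §0 derives `hAloc` from ★ (α)'s coordinate reading `hΨ` (★ C131-p02 `exists_archLetters_scalarType{,_neg}`).  Per term: transport + Fubini
★ p864260 (unconditional); the scalar through the integral (`integral_const_mul`, unconditional); the finite sum through the integral under the per-term INTEGRABILITY letter `hint`
(BY VALUE; payer ★ K2Liu-p03 `integrable_conj_unipDeltaChar_mul_of_archLetters` ∕ ★ p864234 lineage, or LH4-p17's per-term `hint`).
* §0 **`exists_localContinuation_of_scalarType`** — ONE local factor read at scalar type ⟹ its `hAloc` clause (★ C131-p02, either sign; `N` from `exists_nat_gt`).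
* §1 GENERIC **`exists_continuation_of_frameTensorSum`** — `F s u = Σ_{r∈R} γ r s · ∏_w Ψloc r w s (Fr u w)` + `hint` + `hAloc` ⟹ `∃ E` (holomorphic, `= local blocks` on `{½ < re}`),
  `s ↦ Σ_{r∈R} γ r s · (c · ∏_w E r w s)` holomorphic on `{0 < re}` and `= ∫ F_s dν` on `{½ < re}`.
* §2 AT THE K2_Liu FRAME **`hloc_archLetters_of_frameTensorSum`** — `Ω := N_Δ(L⁺⊗ℝ)`, `F s u := conj ψ_S(u_∞)·bA_s((w_Δ)_∞ u h_∞)` (★ FILE 4's `hloc` integrand TOKEN FOR TOKEN) ⊢ (F-arch)'s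
  `(Ainfc, hAinfc, hAinf)` + the per-term, per-place witness (for (σ-A)'s `hdead∞`: one dead real place `w₀` kills EVERY term's product, hence the sum — ★ p863937 §2(a) per term).
References: [KudlaRallis1994] §2 (2.10)–(2.12); [Shimura1982] §4 Thm. 4.2; [HarrisKudlaSweet1996] §1 (1.15)–(1.17); [Tate1967] §3 Thm. 3.3.1; [BorelJacquet1979] §4.1.
HONEST LABEL.  Count-neutral composition: `HC_CM` is proved only modulo the 7 printed citations (2 remaining named inputs: hLiu418 = `stmt-HodgeConjecture-24832`,
h413 = `stmt-HodgeConjecture-24833`) until rung 0 closes; U1-glob LEVEL 2 stays OPEN (`hsum` = the shared core at `A := b`, `g := Λĝ·h`; `hint`; `hAloc`; `htrans` by name; `hdead∞` = (σ-A)).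
-/

set_option autoImplicit false
set_option linter.dupNamespace false -- the mandated namespace repeats `HodgeConjecture.HodgeConjecture`

noncomputable section

open scoped Matrix NNReal ComplexOrder ComplexConjugate
open Complex MeasureTheory Matrix NumberField NumberField.InfinitePlace IsDedekindDomain
open Literature.NumberTheory.Automorphic Literature.NumberTheory.Automorphic.UnitaryGroup Literature.NumberTheory.GaloisRepresentations
open Literature.NumberTheory.GelbartRogawski1991 Literature.NumberTheory.GelbartRogawski1991.GRConstruction
open Literature.NumberTheory.K2Lit.SiegelDoubled

namespace Summit.HodgeConjecture.HodgeConjecture.Cruxes.HLiu418.K2LiuLocalKernelArchPresentationScalarType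

open K2LiuSiegelUnipotentFourierDefs
open K2LiuSiegelUnipotentLocalDefs
open K2LiuHermTwoGammaDefs
open K2LiuArchInducedTubeDefs
open K2LiuIncoherentRankOneArchPlaceTensor (integral_eq_mul_prod_of_frameTensor)
open K2LiuArchTwistedKTypeBlockContinuation (exists_archLetters_scalarType exists_archLetters_scalarType_neg)

/-! ## §0 One local factor read at scalar type: its local continuation clause -/

/-- **THE LOCAL CONTINUATION CLAUSE OF A FACTOR READ AT SCALAR TYPE.**  If in coordinates the local factor reads `Ψ s (nfr ρ) = e(−τ(T·hermOfReal ρ)) · f⁰_{s,k}(J·n(hermOfReal ρ)·hfr)` with a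
rank-one index `T = ±a·hermTwo(t,0,0)·aᴴ` of either sign (`‖det a‖ = 1`, `t > 0`) and `hfr ∈ U(J)`, then `∃ E` holomorphic on `{0 < re s}` with `∫ Ψ s (nfr ρ) dρ = E s` on `{½ < re s}`
(★ C131-p02 `exists_archLetters_scalarType{,_neg}`, `N` from `exists_nat_gt`) — §1's `hAloc` clause for that factor. [cite: Shimura1982, §4 Thm. 4.2] [cite: KudlaRallis1994, §2] -/
theorem exists_localContinuation_of_scalarType {Mfr : Type*} (nfr : (Fin 2 → Fin 2 → ℝ) → Mfr) (Ψ : ℂ → Mfr → ℂ)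
    (k : ℤ) {a : Matrix (Fin 2) (Fin 2) ℂ} (hdet : ‖a.det‖ = 1) {t : ℝ} (ht : 0 < t) (Tidx : Matrix (Fin 2) (Fin 2) ℂ)
    (hT : Tidx = a * hermTwo (t, 0, 0) * aᴴ ∨ Tidx = -(a * hermTwo (t, 0, 0) * aᴴ))
    {hfr : Matrix (Fin 2 ⊕ Fin 2) (Fin 2 ⊕ Fin 2) ℂ} (hhfr : hfrᴴ * Matrix.J (Fin 2) ℂ * hfr = Matrix.J (Fin 2) ℂ)
    (hΨ : ∀ (s : ℂ) (ρ' : Fin 2 → Fin 2 → ℝ), Ψ s (nfr ρ') =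
      cexp (-(2 * Real.pi * I) * (Tidx * hermOfReal ρ').trace) * archScalarSection k s (Matrix.J (Fin 2) ℂ * fromBlocks 1 (hermOfReal ρ') 0 1 * hfr)) :
    ∃ E : ℂ → ℂ, DifferentiableOn ℂ E {s : ℂ | 0 < s.re} ∧ ∀ s : ℂ, 1 / 2 < s.re → ∫ ρ' : Fin 2 → Fin 2 → ℝ, Ψ s (nfr ρ') = E s := by
  have hcongr : ∀ s : ℂ, ∫ ρ' : Fin 2 → Fin 2 → ℝ, Ψ s (nfr ρ') = ∫ ρ' : Fin 2 → Fin 2 → ℝ,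
      cexp (-(2 * Real.pi * I) * (Tidx * hermOfReal ρ').trace) * archScalarSection k s (Matrix.J (Fin 2) ℂ * fromBlocks 1 (hermOfReal ρ') 0 1 * hfr) :=
    fun s => integral_congr_ae (Filter.Eventually.of_forall fun ρ' => hΨ s ρ')
  rcases hT with hpos | hneg
  · obtain ⟨N, hN⟩ := exists_nat_gt (((k : ℤ) : ℝ) / 2)
    obtain ⟨Ac, hAcd, hAceq⟩ := exists_archLetters_scalarType k hdet ht hN
    refine ⟨fun s => Ac s hfr, hAcd _ hhfr, fun s hs => ?_⟩
    rw [hcongr s, hpos]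
    exact hAceq s hs _ hhfr
  · obtain ⟨N, hN⟩ := exists_nat_gt (-((k : ℤ) : ℝ) / 2)
    obtain ⟨Ac, hAcd, hAceq⟩ := exists_archLetters_scalarType_neg k hdet ht hN
    refine ⟨fun s => Ac s hfr, hAcd _ hhfr, fun s hs => ?_⟩
    rw [hcongr s, hneg]
    exact hAceq s hs _ hhfr

/-! ## §1 Generic: a finite sum of frame-pure terms with abstract local continuations continues to `{0 < re s}` -/

/-- **CONTINUATION OF A FINITE SUM OF FRAME-PURE TERMS (generic).**  A measure `ν` on `Ω`, a frame `(Fr, nfr, c)` with the transport letter `htrans` (★ `exists_integral_frame_eq_smul`'s shape);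
an integrand family `F s u = Σ_{r∈R} γ r s · ∏_w Ψloc r w s (Fr u w)` (finitely many frame-pure terms with holomorphic scalars `γ r` — the shared presentation core's `hpres`), each term
INTEGRABLE on `{½ < re s}` (`hint`), and per `(r, w)` the LOCAL CONTINUATION clause `hAloc` (§0 at scalar type, or ★ (D-arch-loc)'s letters).  THEN `∃ E`, every `E r w` (`r ∈ R`) holomorphic
on `{0 < re s}` and equal to the `(r, w)` local block on `{½ < re s}`; `s ↦ Σ_{r∈R} γ r s · (c · ∏_w E r w s)` is holomorphic on `{0 < re s}` and equals `∫ F_s dν` on `{½ < re s}`.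
[cite: KudlaRallis1994, §2 (2.10)–(2.12)] [cite: Tate1967, §3 Thm. 3.3.1] [cite: HarrisKudlaSweet1996, §1 (1.15)–(1.17)] -/
theorem exists_continuation_of_frameTensorSum {Ω σ Mfr ρ : Type*} [MeasurableSpace Ω] (ν : Measure Ω) [Fintype σ]
    (Fr : Ω → σ → Mfr) (nfr : σ → (Fin 2 → Fin 2 → ℝ) → Mfr) (c : ℝ≥0)
    (htrans : ∀ Ψ : (σ → Mfr) → ℂ, ∫ u, Ψ (Fr u) ∂ν = c • ∫ r : σ → (Fin 2 → Fin 2 → ℝ), Ψ (fun w => nfr w (r w)))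
    (R : Finset ρ) (F : ℂ → Ω → ℂ) (γ : ρ → ℂ → ℂ) (hγ : ∀ r ∈ R, DifferentiableOn ℂ (γ r) {s : ℂ | 0 < s.re})
    (Ψloc : ρ → σ → ℂ → Mfr → ℂ)
    (hsum : ∀ (s : ℂ) (u : Ω), F s u = ∑ r ∈ R, γ r s * ∏ w, Ψloc r w s (Fr u w))
    (hint : ∀ r ∈ R, ∀ s : ℂ, 1 / 2 < s.re → Integrable (fun u => ∏ w, Ψloc r w s (Fr u w)) ν)
    (hAloc : ∀ r ∈ R, ∀ w : σ, ∃ E : ℂ → ℂ, DifferentiableOn ℂ E {s : ℂ | 0 < s.re} ∧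
      ∀ s : ℂ, 1 / 2 < s.re → ∫ ρ' : Fin 2 → Fin 2 → ℝ, Ψloc r w s (nfr w ρ') = E s) :
    ∃ E : ρ → σ → ℂ → ℂ,
      (∀ r ∈ R, ∀ w, DifferentiableOn ℂ (E r w) {s : ℂ | 0 < s.re}) ∧
      (∀ r ∈ R, ∀ (w : σ) (s : ℂ), 1 / 2 < s.re → ∫ ρ' : Fin 2 → Fin 2 → ℝ, Ψloc r w s (nfr w ρ') = E r w s) ∧
      DifferentiableOn ℂ (fun s => ∑ r ∈ R, γ r s * (((c : ℝ) : ℂ) * ∏ w, E r w s)) {s : ℂ | 0 < s.re} ∧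
      ∀ s : ℂ, 1 / 2 < s.re → ∫ u, F s u ∂ν = ∑ r ∈ R, γ r s * (((c : ℝ) : ℂ) * ∏ w, E r w s) := by
  classical
  -- the local continuations, chosen on `R` (junk `0` off `R`)
  have key : ∀ p : {r // r ∈ R} × σ, ∃ E : ℂ → ℂ, DifferentiableOn ℂ E {s : ℂ | 0 < s.re} ∧
      ∀ s : ℂ, 1 / 2 < s.re → ∫ ρ' : Fin 2 → Fin 2 → ℝ, Ψloc p.1.1 p.2 s (nfr p.2 ρ') = E s := fun p => hAloc p.1.1 p.1.2 p.2
  choose E' hE'd hE'eq using key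
  refine ⟨fun r w => if hr : r ∈ R then E' (⟨r, hr⟩, w) else 0, fun r hr w => ?_, fun r hr w s hs => ?_, ?_, fun s hs => ?_⟩
  · simp only [dif_pos hr]; exact hE'd (⟨r, hr⟩, w)
  · simp only [dif_pos hr]; exact hE'eq (⟨r, hr⟩, w) s hs
  · refine DifferentiableOn.fun_sum fun r hr => (hγ r hr).mul ((differentiableOn_const _).mul (DifferentiableOn.fun_finsetProd fun w _ => ?_))
    simp only [dif_pos hr]; exact hE'd (⟨r, hr⟩, w)
  · -- the sum through the integral (per-term integrability), the scalar through the integral, transport + Fubini per term, the local blocks by their continuations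
    rw [show F s = fun u => ∑ r ∈ R, γ r s * ∏ w, Ψloc r w s (Fr u w) from funext (hsum s),
      integral_finsetSum _ (fun r hr => (hint r hr s hs).const_mul (γ r s))]
    refine Finset.sum_congr rfl fun r hr => ?_
    rw [integral_const_mul, integral_eq_mul_prod_of_frameTensor ν Fr nfr c htrans (fun w m => Ψloc r w s m) (fun u => rfl)]
    congr 2
    exact Finset.prod_congr rfl fun w _ => by simp only [dif_pos hr]; exact hE'eq (⟨r, hr⟩, w) s hs

/-! ## §2 At the K2_Liu frame: (F-arch)'s arch reading letter for a frame-tensor sum, with the per-term witness -/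

section Frame

variable (L : Type) [Field L] [NumberField L] [IsCMField L]
variable {N M n : ℕ} (e : Fin N × Fin M ≃ Fin n)
  (dV : Fin N → L) (hdV : ∀ i, IsCMField.complexConj L (dV i) = dV i)
  (dW : Fin M → L) (hdW : ∀ i, IsCMField.complexConj L (dW i) = dW i)

/-- **(α)-Σ THE ARCH READING FOR A FRAME-TENSOR SUM — `(Ainfc, hAinfc, hAinf)` of ★ `archCornerPackage_cm` for the block `A∞ s = ∫ conj ψ_S(u_∞)·bA_s((w_Δ)_∞ u h_∞) dν_∞` of ★ FILE 4's
`hloc`.**  BY VALUE: the transport letter `htrans` (★ `exists_integral_frame_eq_smul` at `ν_∞`), the SUM PRESENTATION `hsum` of the integrand (the shared core at `A := b`, `g := Λĝ·h`: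
finitely many frame-pure terms with holomorphic scalars `γ r`), the per-term integrability `hint`, and the per-`(r,w)` local continuation clauses `hAloc` (§0 ∕ ★ (D-arch-loc)).  THEN `∃ Ainfc`
holomorphic on `{0 < re}` with `A∞ s = Ainfc s` on `{1 < re}`, and the WITNESS `Ainfc s = Σ_r γ r s · (c · ∏_w E r w s)`, every `E r w` (`r ∈ R`) holomorphic on `{0 < re}` and equal to the
`(r, w)` local block on `{½ < re}`. [cite: KudlaRallis1994, §2 (2.10)–(2.12)] [cite: HarrisKudlaSweet1996, §1 (1.15)–(1.17)] [cite: BorelJacquet1979, §4.1] -/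
theorem hloc_archLetters_of_frameTensorSum [Fintype {w : InfinitePlace L // w.IsComplex}] [MeasurableSpace ↥(unipDeltaArch L e dV hdV dW hdW)]
    (νinf : Measure ↥(unipDeltaArch L e dV hdV dW hdW)) (S : Matrix (Fin n) (Fin n) L) (h : HA L e dV hdV dW hdW) (bA : ℂ → UnitaryGroup.arch (Fp L) L (IsCMField.complexConj L) (n + n) (hermD L e dV hdV dW hdW) → ℂ)
    {Mfr : Type*} (Fr : ↥(unipDeltaArch L e dV hdV dW hdW) → {w : InfinitePlace L // w.IsComplex} → Mfr) (nfr : {w : InfinitePlace L // w.IsComplex} → (Fin 2 → Fin 2 → ℝ) → Mfr) (c : ℝ≥0)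
    (htrans : ∀ Ψ : ({w : InfinitePlace L // w.IsComplex} → Mfr) → ℂ, ∫ u, Ψ (Fr u) ∂νinf = c • ∫ r : {w : InfinitePlace L // w.IsComplex} → (Fin 2 → Fin 2 → ℝ), Ψ (fun w => nfr w (r w)))
    {ρ : Type*} (R : Finset ρ) (γ : ρ → ℂ → ℂ) (hγ : ∀ r ∈ R, DifferentiableOn ℂ (γ r) {s : ℂ | 0 < s.re})
    (Ψloc : ρ → {w : InfinitePlace L // w.IsComplex} → ℂ → Mfr → ℂ)
    (hsum : ∀ (s : ℂ) (u : ↥(unipDeltaArch L e dV hdV dW hdW)),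
      conj (unipDeltaChar L e dV hdV dW hdW S (UnitaryGroup.archToAdelic (Fp L) L (IsCMField.complexConj L) (n + n) (hermD L e dV hdV dW hdW) (u : UnitaryGroup.arch (Fp L) L (IsCMField.complexConj L) (n + n) (hermD L e dV hdV dW hdW))) : ℂ) *
          bA s (UnitaryGroup.archPart (Fp L) L (IsCMField.complexConj L) (n + n) (hermD L e dV hdV dW hdW) (weylDelta L e dV hdV dW hdW) * (u : UnitaryGroup.arch (Fp L) L (IsCMField.complexConj L) (n + n) (hermD L e dV hdV dW hdW)) * UnitaryGroup.archPart (Fp L) L (IsCMField.complexConj L) (n + n) (hermD L e dV hdV dW hdW) h) =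
        ∑ r ∈ R, γ r s * ∏ w, Ψloc r w s (Fr u w))
    (hint : ∀ r ∈ R, ∀ s : ℂ, 1 / 2 < s.re → Integrable (fun u => ∏ w, Ψloc r w s (Fr u w)) νinf)
    (hAloc : ∀ r ∈ R, ∀ w : {w : InfinitePlace L // w.IsComplex}, ∃ E : ℂ → ℂ, DifferentiableOn ℂ E {s : ℂ | 0 < s.re} ∧
      ∀ s : ℂ, 1 / 2 < s.re → ∫ ρ' : Fin 2 → Fin 2 → ℝ, Ψloc r w s (nfr w ρ') = E s) :
    ∃ Ainfc : ℂ → ℂ, DifferentiableOn ℂ Ainfc {s : ℂ | 0 < s.re} ∧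
      (∀ s : ℂ, 1 < s.re →
        (∫ u, conj (unipDeltaChar L e dV hdV dW hdW S (UnitaryGroup.archToAdelic (Fp L) L (IsCMField.complexConj L) (n + n) (hermD L e dV hdV dW hdW) (u : UnitaryGroup.arch (Fp L) L (IsCMField.complexConj L) (n + n) (hermD L e dV hdV dW hdW))) : ℂ) *
            bA s (UnitaryGroup.archPart (Fp L) L (IsCMField.complexConj L) (n + n) (hermD L e dV hdV dW hdW) (weylDelta L e dV hdV dW hdW) * (u : UnitaryGroup.arch (Fp L) L (IsCMField.complexConj L) (n + n) (hermD L e dV hdV dW hdW)) * UnitaryGroup.archPart (Fp L) L (IsCMField.complexConj L) (n + n) (hermD L e dV hdV dW hdW) h) ∂νinf) = Ainfc s) ∧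
      ∃ E : ρ → {w : InfinitePlace L // w.IsComplex} → ℂ → ℂ,
        (∀ r ∈ R, ∀ w, DifferentiableOn ℂ (E r w) {s : ℂ | 0 < s.re}) ∧
        (∀ r ∈ R, ∀ (w : {w : InfinitePlace L // w.IsComplex}) (s : ℂ), 1 / 2 < s.re → ∫ ρ' : Fin 2 → Fin 2 → ℝ, Ψloc r w s (nfr w ρ') = E r w s) ∧
        ∀ s : ℂ, Ainfc s = ∑ r ∈ R, γ r s * (((c : ℝ) : ℂ) * ∏ w, E r w s) := by
  obtain ⟨E, hEd, hEeq, hdiff, hval⟩ := exists_continuation_of_frameTensorSum νinf Fr nfr c htrans R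
    (fun s u => conj (unipDeltaChar L e dV hdV dW hdW S (UnitaryGroup.archToAdelic (Fp L) L (IsCMField.complexConj L) (n + n) (hermD L e dV hdV dW hdW) (u : UnitaryGroup.arch (Fp L) L (IsCMField.complexConj L) (n + n) (hermD L e dV hdV dW hdW))) : ℂ) *
      bA s (UnitaryGroup.archPart (Fp L) L (IsCMField.complexConj L) (n + n) (hermD L e dV hdV dW hdW) (weylDelta L e dV hdV dW hdW) * (u : UnitaryGroup.arch (Fp L) L (IsCMField.complexConj L) (n + n) (hermD L e dV hdV dW hdW)) * UnitaryGroup.archPart (Fp L) L (IsCMField.complexConj L) (n + n) (hermD L e dV hdV dW hdW) h))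
    γ hγ Ψloc hsum hint hAloc
  exact ⟨fun s => ∑ r ∈ R, γ r s * (((c : ℝ) : ℂ) * ∏ w, E r w s), hdiff, fun s hs => hval s (by linarith), E, hEd, hEeq, fun s => rfl⟩

end Frame

end Summit.HodgeConjecture.HodgeConjecture.Cruxes.HLiu418.K2LiuLocalKernelArchPresentationScalarType

end
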